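import Literature.NumberTheory.Automorphic.Liu2021.AppendixC.CMEigenlineRankOne
import Literature.NumberTheory.Automorphic.Liu2021.AppendixC.RestOne
import Literature.AlgebraicGeometry.Motives.FaltingsAbelianRational
import Literature.RepresentationTheory.IntertwiningMapBaseChange
import Literature.RepresentationTheory.IntertwiningMapDualTranspose
import HarnessLib

/-!
# Pull-back on `ℚ_ℓ^{ac} ⊗ H¹_ét` along homomorphisms of abelian varieties; Faltings' isogeny theorem and Mumford's
# injectivity read on `H¹` ([Liu 2021, Thm 4.18 proof l. 2254–2262])

Topic `NumberTheory/Automorphic/Liu2021/AppendixC`; namespace `Literature.NumberTheory.Automorphic.Liu2021.AppendixC`.  Definitions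
with bodies + theorems; no named fact, no `sorry`; net Literature debt 0.  Cell `hodgecm-mathlib` (D-0151), line `a3-liu418` v3, stub F
`stub_faltingsIsotypic` (KEY `a3-faltings-isotypic`, seat A-p17): the LEVEL-`K` algebra of the Faltings step, generic over two abelian
varieties `X` (`= A_K = Alb X_K`) and `B` (`= A_μ`) over a field `E`.  HC_CM is proved only modulo the 7 printed citations until rung 0
closes; the Faltings statement here is CONDITIONAL on the named fact `Motives.faltings_tate_bijective X B ℓ` (VI-1), taken as a hypothesis.

## The printed text (Y. Liu, arXiv:2102.11518, `FJcycle.tex` l. 2254–2262, print pp. 52–53)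

«By the comparison theorem, (4.2) induces the following map `Ω(μ) ⊗_{M_μ,ι_ℓ} ℚ_ℓ^{ac} → Hom(…, H¹_ét(A_∞ ⊗_{E,τ'} ℂ, ℚ_ℓ^{ac}))` […]
By Faltings' isogeny theorem [Fal83], we have a canonical isomorphism
`Ω(μ) ⊗_{M_μ,ι_ℓ} ℚ_ℓ^{ac} ≃ Hom_{ℚ_ℓ^{ac}[Gal(ℂ/τ'(E))]}(ℚ_ℓ^{ac}·α, H¹_ét(A_μ ⊗_{E,τ'} ℂ, ℚ_ℓ^{ac}))`.»  At finite level `K`,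
`Ω(μ)_K = Hom_E(A_K, A_μ)_ℚ` (Rem. 4.17) and the map is `φ ↦ φ^* = ᵗV_ℓ(φ)` on `H¹_ét = V_ℓ^∨` (`EtaleH1Tower.lean`).

## Contents (all PROVED; axioms `propext`, `Classical.choice`, `Quot.sound`)

* §1 `h1PullBar ℓ f = 1 ⊗ ᵗV_ℓ(f) : ℚ_ℓ^{ac} ⊗ H¹_ét(B) → ℚ_ℓ^{ac} ⊗ H¹_ét(X)` for `f : X → B` (`_add/_zero/_comp/_id`, `Γ_E`-equivariance
  `galoisH1Bar_comp_h1PullBar`, `h1PullBar_comp_end`); its `ℚ`-linear extension `h1PullBarQ` to `ℚ ⊗_ℤ Hom_E(X, B)` (`RestOne.QHom`;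
  `_tmul`, `_pre` = compatibility with `RestOne.pre`, `_postAlg` = «`M_μ` acts via `i_μ`» becomes precomposition with `1 ⊗ ᵗV_ℓ(e)`,
  `galoisH1Bar_comp_h1PullBarQ`); and the `ℚ_ℓ^{ac}`-linear `h1PullBarK : ℚ_ℓ^{ac} ⊗_ℚ (ℚ ⊗ Hom) → Hom_{ℚ_ℓ^{ac}}(ℚ_ℓ^{ac} ⊗ H¹_ét(B), ℚ_ℓ^{ac} ⊗ H¹_ét(X))`.
* §2 **`mem_span_h1PullBar_of_galois`** — [Faltings 1983, Satz 4 / Kor. 1] on `H¹`: granted `faltings_tate_bijective X B ℓ`, every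
  `Γ_E`-equivariant `ℚ_ℓ^{ac}`-linear `H : ℚ_ℓ^{ac} ⊗ H¹_ét(B) → ℚ_ℓ^{ac} ⊗ H¹_ét(X)` is a `ℚ_ℓ^{ac}`-combination of pull-backs `f^*`
  (B-typ04's `faltings_rationalTate_bijective_of` (g1) + `IntertwiningDual.detranspose` (g3) + `IntertwiningBaseChange.psi_surjOn` (g2));
  **`linearIndependent_h1PullBar`**, **`h1PullBarK_injective`** — [Mumford §19 Thm 3] with coefficients `ℚ_ℓ^{ac}` on `H¹`
  (UNCONDITIONAL, `ℓ` invertible in `E`: B-typ04's `linearIndependent_rationalTateModuleMap_hom_of_linearIndependent_int`, the dual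
  separates points, `IntertwiningBaseChange.homEquiv`, and `module_free_hom_holds` / `module_finite_hom_holds`).

References: [Liu2021] Thm 4.18 proof l. 2254–2262, Def. 4.16 l. 2219, §4.2 l. 2070–2072; [Faltings1983Endlichkeit] G. Faltings, Invent. Math.
73 (1983), §5 Satz 4, Korollar 1; [MumfordAV1970] D. Mumford, *Abelian Varieties*, §19 Thm. 3; [SerreTate1968] §1 (`V_ℓ`).
-/

noncomputable section

open CategoryTheory NumberField
open scoped TensorProduct

namespace Literature.NumberTheory.Automorphic.Liu2021.AppendixC

open Literature.AlgebraicGeometry.Motives (AbelianVariety faltings_tate_bijective faltings_rationalTate_bijective_of)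
open Literature.AlgebraicGeometry.Motives.AbelianVariety (rationalTateModuleMap rationalTateModuleMap_comp rationalTateModuleMap_add
  rationalTateModuleMap_zero rationalTateModuleMap_id rationalTateRep_rationalTateModuleMap rationalTateAction rationalTateAction_of
  rationalTateAction_algebraMap module_finite_tateModule_of_cast_ne_zero endAlgebra faltingsRationalTateMap rationalTateHom
  toLinearMap_rationalTateIntertwiningMap faltingsRationalTateMap_tmul)
open Literature.RepresentationTheory.IntertwiningBaseChange Literature.RepresentationTheory.IntertwiningDual

/-! ## §1 `f^* = 1 ⊗ ᵗV_ℓ(f)` on `ℚ_ℓ^{ac} ⊗_{ℚ_ℓ} H¹_ét` -/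

section Pullback

variable {E : Type} [Field E] (ℓ : ℕ) [Fact ℓ.Prime] {X X' B : AbelianVariety E}

/-- **Pull-back `f^* : ℚ_ℓ^{ac} ⊗ H¹_ét(B) → ℚ_ℓ^{ac} ⊗ H¹_ét(X)`** along a homomorphism `f : X → B` of abelian varieties over `E`:
`1 ⊗ ᵗV_ℓ(f)` with `H¹_ét = V_ℓ^∨` (the maps «induced by pulling back», [Liu2021] l. 2254–2268; the transition maps `etSys` of
`EtaleH1Tower.lean` are the case `f = Alb_u`, before `⊗ ℚ_ℓ^{ac}`). [cite: Liu2021, Thm 4.18 proof (FJcycle.tex l. 2254–2262)] -/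
def h1PullBar (f : X ⟶ B) :
    AlgebraicClosure ℚ_[ℓ] ⊗[ℚ_[ℓ]] Module.Dual ℚ_[ℓ] (B.rationalTateModule ℓ) →ₗ[AlgebraicClosure ℚ_[ℓ]]
      AlgebraicClosure ℚ_[ℓ] ⊗[ℚ_[ℓ]] Module.Dual ℚ_[ℓ] (X.rationalTateModule ℓ) :=
  ((rationalTateModuleMap ℓ f).dualMap).baseChange (AlgebraicClosure ℚ_[ℓ])

/-- unfolding of `h1PullBar`. [cite: Liu2021, Thm 4.18 proof (FJcycle.tex l. 2254–2262)] -/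
theorem h1PullBar_def (f : X ⟶ B) :
    h1PullBar ℓ f = ((rationalTateModuleMap ℓ f).dualMap).baseChange (AlgebraicClosure ℚ_[ℓ]) :=
  rfl

/-- `(f + g)^* = f^* + g^*`. [cite: Liu2021, Thm 4.18 proof (FJcycle.tex l. 2254–2262)] -/
theorem h1PullBar_add (f g : X ⟶ B) : h1PullBar ℓ (f + g) = h1PullBar ℓ f + h1PullBar ℓ g := by
  rw [h1PullBar, h1PullBar, h1PullBar, rationalTateModuleMap_add]
  change (Module.Dual.transpose (R := ℚ_[ℓ]) (rationalTateModuleMap ℓ f + rationalTateModuleMap ℓ g)).baseChange _ = _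
  rw [map_add, LinearMap.baseChange_add]
  rfl

/-- `0^* = 0`. [cite: Liu2021, Thm 4.18 proof (FJcycle.tex l. 2254–2262)] -/
theorem h1PullBar_zero : h1PullBar ℓ (0 : X ⟶ B) = 0 := by
  rw [h1PullBar, rationalTateModuleMap_zero]
  change (Module.Dual.transpose (R := ℚ_[ℓ]) (0 : X.rationalTateModule ℓ →ₗ[ℚ_[ℓ]] B.rationalTateModule ℓ)).baseChange _ = 0
  rw [map_zero, LinearMap.baseChange_zero]

/-- `(u ≫ f)^* = u^* ∘ f^*` (contravariance). [cite: Liu2021, Thm 4.18 proof (FJcycle.tex l. 2254–2262)] -/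
theorem h1PullBar_comp (u : X' ⟶ X) (f : X ⟶ B) : h1PullBar ℓ (u ≫ f) = h1PullBar ℓ u ∘ₗ h1PullBar ℓ f := by
  rw [h1PullBar, h1PullBar, h1PullBar, rationalTateModuleMap_comp, ← LinearMap.dualMap_comp_dualMap, LinearMap.baseChange_comp]

/-- `𝟙^* = id`. [cite: Liu2021, Thm 4.18 proof (FJcycle.tex l. 2254–2262)] -/
theorem h1PullBar_id : h1PullBar ℓ (𝟙 X) = LinearMap.id := by
  rw [h1PullBar, rationalTateModuleMap_id, LinearMap.dualMap_id, LinearMap.baseChange_id]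

/-- `f^*` is `Γ_E`-equivariant: `(σ ⊗ 1) ∘ f^* = f^* ∘ (σ ⊗ 1)` (`V_ℓ f` commutes with `Γ_E`, dualised, base-changed).
[cite: Liu2021, Thm 4.18 proof (FJcycle.tex l. 2254–2262)] -/
theorem galoisH1Bar_comp_h1PullBar (σ : Field.absoluteGaloisGroup E) (f : X ⟶ B) :
    galoisH1Bar ℓ X σ ∘ₗ h1PullBar ℓ f = h1PullBar ℓ f ∘ₗ galoisH1Bar ℓ B σ := by
  rw [galoisH1Bar, galoisH1Bar, Representation.dual_apply, Representation.dual_apply, h1PullBar, ← LinearMap.baseChange_comp,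
    ← LinearMap.baseChange_comp]
  congr 1
  change ((X.rationalTateRep ℓ) σ⁻¹).dualMap ∘ₗ (rationalTateModuleMap ℓ f).dualMap =
    (rationalTateModuleMap ℓ f).dualMap ∘ₗ ((B.rationalTateRep ℓ) σ⁻¹).dualMap
  rw [LinearMap.dualMap_comp_dualMap, LinearMap.dualMap_comp_dualMap]
  congr 1
  exact LinearMap.ext fun v => rationalTateRep_rationalTateModuleMap ℓ f σ⁻¹ v

/-- Post-composition with an endomorphism `β` of `B`: `(f ≫ β)^* = f^* ∘ (1 ⊗ ᵗV_ℓ(β))`, `V_ℓ(β)` read through `End⁰(B) → End(V_ℓ B)`.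
[cite: Liu2021, Def. 4.16 (FJcycle.tex l. 2219)] -/
theorem h1PullBar_comp_end (f : X ⟶ B) (β : End B) :
    h1PullBar ℓ (f ≫ End.asHom β) =
      h1PullBar ℓ f ∘ₗ ((rationalTateAction B ℓ (endAlgebra.of B β)).dualMap).baseChange (AlgebraicClosure ℚ_[ℓ]) := by
  rw [h1PullBar_comp, rationalTateAction_of]
  rfl

variable (X B) in
/-- `f ↦ f^*` as an additive map `Hom_E(X, B) → Hom(ℚ_ℓ^{ac} ⊗ H¹_ét(B), ℚ_ℓ^{ac} ⊗ H¹_ét(X))`. [cite: Liu2021, Thm 4.18 proof (FJcycle.tex l. 2254–2262)] -/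
def h1PullBarAddHom : (X ⟶ B) →+
    (AlgebraicClosure ℚ_[ℓ] ⊗[ℚ_[ℓ]] Module.Dual ℚ_[ℓ] (B.rationalTateModule ℓ) →ₗ[AlgebraicClosure ℚ_[ℓ]]
      AlgebraicClosure ℚ_[ℓ] ⊗[ℚ_[ℓ]] Module.Dual ℚ_[ℓ] (X.rationalTateModule ℓ)) where
  toFun := h1PullBar ℓ
  map_zero' := h1PullBar_zero ℓ
  map_add' := h1PullBar_add ℓ

variable (X B) in
/-- **`ℚ ⊗_ℤ Hom_E(X, B) → Hom(ℚ_ℓ^{ac} ⊗ H¹_ét(B), ℚ_ℓ^{ac} ⊗ H¹_ét(X))`, `q ⊗ f ↦ q · f^*`** — the `H¹`-form of the Tate map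
«`Ω(μ) ⊗ … → Hom(…, H¹_ét(A_∞ …))`» at one level (l. 2258), `ℚ`-linear. [cite: Liu2021, Thm 4.18 proof (FJcycle.tex l. 2254–2262)] -/
def h1PullBarQ : RestOne.QHom X B →ₗ[ℚ]
    (AlgebraicClosure ℚ_[ℓ] ⊗[ℚ_[ℓ]] Module.Dual ℚ_[ℓ] (B.rationalTateModule ℓ) →ₗ[AlgebraicClosure ℚ_[ℓ]]
      AlgebraicClosure ℚ_[ℓ] ⊗[ℚ_[ℓ]] Module.Dual ℚ_[ℓ] (X.rationalTateModule ℓ)) :=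
  TensorProduct.AlgebraTensorModule.lift
    (((LinearMap.lsmul ℚ _).flip.restrictScalars ℤ ∘ₗ (h1PullBarAddHom ℓ X B).toIntLinearMap).flip)

/-- on pure tensors: `q ⊗ f ↦ q • f^*`. [cite: Liu2021, Thm 4.18 proof (FJcycle.tex l. 2254–2262)] -/
theorem h1PullBarQ_tmul (q : ℚ) (f : X ⟶ B) : h1PullBarQ ℓ X B (q ⊗ₜ[ℤ] f) = (q : AlgebraicClosure ℚ_[ℓ]) • h1PullBar ℓ f := by
  change q • h1PullBar ℓ f = _
  rw [← algebraMap_smul (AlgebraicClosure ℚ_[ℓ]) q, eq_ratCast]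

/-- pull-back along `u : X' → X` on the source: `(u^* t)^* = u^* ∘ t^*` for `t ∈ ℚ ⊗ Hom(X, B)` (`RestOne.pre`).
[cite: Liu2021, §4.2 (FJcycle.tex l. 2070–2072)] -/
theorem h1PullBarQ_pre (u : X' ⟶ X) (t : RestOne.QHom X B) :
    h1PullBarQ ℓ X' B (RestOne.pre B u t) = h1PullBar ℓ u ∘ₗ h1PullBarQ ℓ X B t := by
  induction t using TensorProduct.induction_on with
  | zero => rw [map_zero, map_zero, map_zero, LinearMap.comp_zero]
  | tmul q f => rw [RestOne.pre_tmul, h1PullBarQ_tmul, h1PullBarQ_tmul, h1PullBar_comp, LinearMap.comp_smul]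
  | add x y hx hy => rw [map_add, map_add, map_add, hx, hy, LinearMap.comp_add]

/-- «`M_μ` acts via `i_μ`» read on `H¹`: for `e ∈ End⁰(B)`, `(e_* t)^* = t^* ∘ (1 ⊗ ᵗV_ℓ(e))` (`RestOne.postAlg`).
[cite: Liu2021, Def. 4.16 (FJcycle.tex l. 2219)] -/
theorem h1PullBarQ_postAlg (e : B.endAlgebra) (t : RestOne.QHom X B) :
    h1PullBarQ ℓ X B (RestOne.postAlg X B e t) =
      h1PullBarQ ℓ X B t ∘ₗ ((rationalTateAction B ℓ e).dualMap).baseChange (AlgebraicClosure ℚ_[ℓ]) := by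
  obtain ⟨M, β, -, rfl⟩ := AbelianVariety.endAlgebra.exists_eq_algebraMap_mul_of e
  have hact : ((rationalTateAction B ℓ (algebraMap ℚ B.endAlgebra (M : ℚ)⁻¹ * endAlgebra.of B β)).dualMap).baseChange
      (AlgebraicClosure ℚ_[ℓ]) =
      (algebraMap ℚ (AlgebraicClosure ℚ_[ℓ]) (M : ℚ)⁻¹) •
        ((rationalTateAction B ℓ (endAlgebra.of B β)).dualMap).baseChange (AlgebraicClosure ℚ_[ℓ]) := by
    rw [map_mul, rationalTateAction_algebraMap, ← Algebra.smul_def]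
    change (Module.Dual.transpose (R := ℚ_[ℓ])
      (algebraMap ℚ ℚ_[ℓ] (M : ℚ)⁻¹ • rationalTateAction B ℓ (endAlgebra.of B β))).baseChange _ = _
    rw [map_smul, LinearMap.baseChange_smul, ← algebraMap_smul (AlgebraicClosure ℚ_[ℓ]) (algebraMap ℚ ℚ_[ℓ] (M : ℚ)⁻¹),
      ← IsScalarTower.algebraMap_apply]
    rfl
  rw [hact, LinearMap.comp_smul]
  induction t using TensorProduct.induction_on with
  | zero => rw [map_zero, map_zero, LinearMap.zero_comp, smul_zero]
  | tmul q f =>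
    rw [map_mul, Module.End.mul_apply, RestOne.postAlg_of, RestOne.post_tmul, AlgHom.commutes, Module.algebraMap_end_apply,
      map_smul, h1PullBarQ_tmul, h1PullBarQ_tmul, h1PullBar_comp_end, LinearMap.smul_comp, algebraMap_smul]
  | add x y hx hy => rw [map_add, map_add, map_add, hx, hy, LinearMap.add_comp, smul_add]

/-- `t^*` is `Γ_E`-equivariant for every `t ∈ ℚ ⊗ Hom_E(X, B)`. [cite: Liu2021, Thm 4.18 proof (FJcycle.tex l. 2254–2262)] -/
theorem galoisH1Bar_comp_h1PullBarQ (σ : Field.absoluteGaloisGroup E) (t : RestOne.QHom X B) :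
    galoisH1Bar ℓ X σ ∘ₗ h1PullBarQ ℓ X B t = h1PullBarQ ℓ X B t ∘ₗ galoisH1Bar ℓ B σ := by
  induction t using TensorProduct.induction_on with
  | zero => rw [map_zero, LinearMap.comp_zero, LinearMap.zero_comp]
  | tmul q f => rw [h1PullBarQ_tmul, LinearMap.comp_smul, LinearMap.smul_comp, galoisH1Bar_comp_h1PullBar]
  | add x y hx hy => rw [map_add, LinearMap.comp_add, LinearMap.add_comp, hx, hy]

variable (X B) in
/-- **`ℚ_ℓ^{ac} ⊗_ℚ (ℚ ⊗_ℤ Hom_E(X, B)) → Hom(ℚ_ℓ^{ac} ⊗ H¹_ét(B), ℚ_ℓ^{ac} ⊗ H¹_ét(X))`, `c ⊗ t ↦ c · t^*`** — the Tate map of l. 2258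
read on `H¹` with coefficients `ℚ_ℓ^{ac}`, BEFORE cutting by the line `ℚ_ℓ^{ac}·α`. [cite: Liu2021, Thm 4.18 proof (FJcycle.tex l. 2254–2262)] -/
def h1PullBarK : AlgebraicClosure ℚ_[ℓ] ⊗[ℚ] RestOne.QHom X B →ₗ[AlgebraicClosure ℚ_[ℓ]]
    (AlgebraicClosure ℚ_[ℓ] ⊗[ℚ_[ℓ]] Module.Dual ℚ_[ℓ] (B.rationalTateModule ℓ) →ₗ[AlgebraicClosure ℚ_[ℓ]]
      AlgebraicClosure ℚ_[ℓ] ⊗[ℚ_[ℓ]] Module.Dual ℚ_[ℓ] (X.rationalTateModule ℓ)) :=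
  TensorProduct.AlgebraTensorModule.lift
    (((LinearMap.lsmul (AlgebraicClosure ℚ_[ℓ]) _).flip.restrictScalars ℚ ∘ₗ h1PullBarQ ℓ X B).flip)

/-- on pure tensors: `c ⊗ t ↦ c • t^*`. [cite: Liu2021, Thm 4.18 proof (FJcycle.tex l. 2254–2262)] -/
theorem h1PullBarK_tmul (c : AlgebraicClosure ℚ_[ℓ]) (t : RestOne.QHom X B) :
    h1PullBarK ℓ X B (c ⊗ₜ[ℚ] t) = c • h1PullBarQ ℓ X B t :=
  rfl

end Pullback

/-! ## §2 Faltings' isogeny theorem read on `ℚ_ℓ^{ac} ⊗ H¹_ét`: every `Γ_E`-map is a combination of pull-backs -/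

section Faltings

variable {E : Type} [Field E] [NumberField E] (ℓ : ℕ) [Fact ℓ.Prime] (X B : AbelianVariety E)

/-- `V_ℓ(A)` is finite-dimensional over `ℚ_ℓ` for an abelian variety over a number field (tree
`module_finite_tateModule_of_cast_ne_zero`, `char E = 0`). [cite: SerreTate1968, §1] -/
theorem finite_rationalTateModule (A : AbelianVariety E) : Module.Finite ℚ_[ℓ] (A.rationalTateModule ℓ) := by
  haveI := module_finite_tateModule_of_cast_ne_zero A ℓ
    (Literature.AlgebraicGeometry.Motives.natCast_ne_zero_of_numberField ℓ)
  exact inferInstanceAs (Module.Finite ℚ_[ℓ] (ℚ_[ℓ] ⊗[ℤ_[ℓ]] A.tateModule ℓ))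

/-- **[Faltings 1983, Satz 4 / Korollar 1] on `ℚ_ℓ^{ac} ⊗ H¹_ét`** («By Faltings' isogeny theorem [Fal83], we have a canonical
isomorphism `Ω(μ) ⊗_{M_μ,ι_ℓ} ℚ_ℓ^{ac} ≃ Hom_{Gal}(…, H¹_ét(…))`», [Liu2021] l. 2258–2262 — the surjectivity half at one level,
before cutting by the line): granted the named fact `faltings_tate_bijective X B ℓ` (VI-1, hypothesis `hF`), every
`ℚ_ℓ^{ac}`-linear map `H : ℚ_ℓ^{ac} ⊗ H¹_ét(B) → ℚ_ℓ^{ac} ⊗ H¹_ét(X)` commuting with `Γ_E` is a `ℚ_ℓ^{ac}`-linear combination of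
pull-backs `f^*`, `f ∈ Hom_E(X, B)`.  Proof: `Γ_E`-maps commute with the flat base change `ℚ_ℓ → ℚ_ℓ^{ac}` (B-typ04's
`IntertwiningBaseChange.psi_surjOn`, Bourbaki AC I §2.10 Prop. 11), transpose back to `V_ℓ` (`IntertwiningDual.detranspose`),
and apply rational Faltings (`faltings_rationalTate_bijective_of`). [cite: Faltings1983Endlichkeit, §5 Satz 4 and Korollar 1]
[cite: Liu2021, Thm 4.18 proof (FJcycle.tex l. 2258–2262)] -/
theorem mem_span_h1PullBar_of_galois (hF : faltings_tate_bijective X B ℓ)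
    (H : AlgebraicClosure ℚ_[ℓ] ⊗[ℚ_[ℓ]] Module.Dual ℚ_[ℓ] (B.rationalTateModule ℓ) →ₗ[AlgebraicClosure ℚ_[ℓ]]
      AlgebraicClosure ℚ_[ℓ] ⊗[ℚ_[ℓ]] Module.Dual ℚ_[ℓ] (X.rationalTateModule ℓ))
    (hH : ∀ σ : Field.absoluteGaloisGroup E, H ∘ₗ galoisH1Bar ℓ B σ = galoisH1Bar ℓ X σ ∘ₗ H) :
    H ∈ Submodule.span (AlgebraicClosure ℚ_[ℓ]) (Set.range (h1PullBar ℓ : (X ⟶ B) → _)) := by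
  haveI := finite_rationalTateModule ℓ X
  haveI := finite_rationalTateModule ℓ B
  have hH' : H ∈ intertwiningSubmodule (repBaseChange (AlgebraicClosure ℚ_[ℓ]) (B.rationalTateRep ℓ).dual)
      (repBaseChange (AlgebraicClosure ℚ_[ℓ]) (X.rationalTateRep ℓ).dual) := by
    rw [mem_intertwiningSubmodule_iff]
    intro σ
    rw [repBaseChange_apply, repBaseChange_apply]
    exact hH σ
  obtain ⟨x, hx⟩ := psi_surjOn (AlgebraicClosure ℚ_[ℓ]) _ _ H hH'
  rw [← hx]
  clear hx hH' hH H
  induction x using TensorProduct.induction_on with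
  | zero => rw [map_zero]; exact Submodule.zero_mem _
  | add x y hx hy => rw [map_add]; exact Submodule.add_mem _ hx hy
  | tmul c h =>
    rw [psi_tmul]
    refine Submodule.smul_mem _ c ?_
    -- transpose back to `V_ℓ`: `h = ᵗg` with `g ∈ Hom_{Γ_E}(V_ℓ X, V_ℓ B)`
    set h' := intertwiningSubmoduleEquiv _ _ h with hh'
    set g := detranspose (X.rationalTateRep ℓ) (B.rationalTateRep ℓ) h' with hg
    have hhg : h.1 = g.toLinearMap.dualMap := by
      rw [← intertwiningSubmoduleEquiv_apply_toLinearMap, ← hh', ← dualTranspose_detranspose (X.rationalTateRep ℓ)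
        (B.rationalTateRep ℓ) h', dualTranspose_toLinearMap]
    -- Faltings: `g = Σ a_r V_ℓ(f_r)`
    obtain ⟨t, ht⟩ := (faltings_rationalTate_bijective_of X B ℓ hF).2 g
    rw [hhg, ← ht]
    clear hhg hg ht hh'
    induction t using TensorProduct.induction_on with
    | zero =>
      rw [map_zero, Representation.IntertwiningMap.zero_toLinearMap]
      change (Module.Dual.transpose (R := ℚ_[ℓ]) (0 : X.rationalTateModule ℓ →ₗ[ℚ_[ℓ]] B.rationalTateModule ℓ)).baseChange _ ∈ _
      rw [map_zero, LinearMap.baseChange_zero]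
      exact Submodule.zero_mem _
    | tmul a f =>
      rw [faltingsRationalTateMap_tmul, Representation.IntertwiningMap.toLinearMap_smul, toLinearMap_rationalTateIntertwiningMap]
      change (Module.Dual.transpose (R := ℚ_[ℓ]) (a • rationalTateModuleMap ℓ f)).baseChange _ ∈ _
      rw [map_smul, LinearMap.baseChange_smul]
      exact Submodule.smul_of_tower_mem _ a (Submodule.subset_span ⟨f, rfl⟩)
    | add x y hx hy =>
      rw [map_add, Representation.IntertwiningMap.add_toLinearMap]
      change (Module.Dual.transpose (R := ℚ_[ℓ]) ((faltingsRationalTateMap X B ℓ x).toLinearMap +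
        (faltingsRationalTateMap X B ℓ y).toLinearMap)).baseChange _ ∈ _
      rw [map_add, LinearMap.baseChange_add]
      exact Submodule.add_mem _ hx hy

/-- **[Mumford §19 Thm 3] on `ℚ_ℓ^{ac} ⊗ H¹_ét`: `ℤ`-independent homomorphisms have `ℚ_ℓ^{ac}`-independent pull-backs**
(`ℓ` invertible in `E`): `f_r ↦ f_r^*` — from B-typ04's `linearIndependent_rationalTateModuleMap_hom_of_linearIndependent_int`
(`ℚ_ℓ ⊗ Hom → Hom(V_ℓ X, V_ℓ B)` injective) by transposing (the dual separates points) and base change `ℚ_ℓ → ℚ_ℓ^{ac}`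
(`IntertwiningBaseChange.homEquiv`). [cite: MumfordAV1970, §19 Thm. 3] [cite: Liu2021, Thm 4.18 proof (FJcycle.tex l. 2258–2262)] -/
theorem linearIndependent_h1PullBar {E : Type} [Field E] {X B : AbelianVariety E} (hℓ : (ℓ : E) ≠ 0) {ι : Type*}
    {f : ι → (X ⟶ B)} (hf : LinearIndependent ℤ f) :
    LinearIndependent (AlgebraicClosure ℚ_[ℓ]) fun r => h1PullBar ℓ (f r) := by
  haveI := module_finite_tateModule_of_cast_ne_zero X ℓ hℓ
  haveI := module_finite_tateModule_of_cast_ne_zero B ℓ hℓ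
  haveI : Module.Finite ℚ_[ℓ] (X.rationalTateModule ℓ) := inferInstanceAs (Module.Finite ℚ_[ℓ] (ℚ_[ℓ] ⊗[ℤ_[ℓ]] X.tateModule ℓ))
  haveI : Module.Finite ℚ_[ℓ] (B.rationalTateModule ℓ) := inferInstanceAs (Module.Finite ℚ_[ℓ] (ℚ_[ℓ] ⊗[ℤ_[ℓ]] B.tateModule ℓ))
  have h1 := AbelianVariety.linearIndependent_rationalTateModuleMap_hom_of_linearIndependent_int (ℓ := ℓ) hℓ hf
  -- transpose: the dual of `V_ℓ B` separates points
  have hker : LinearMap.ker (Module.Dual.transpose (R := ℚ_[ℓ]) :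
      (X.rationalTateModule ℓ →ₗ[ℚ_[ℓ]] B.rationalTateModule ℓ) →ₗ[ℚ_[ℓ]] _) = ⊥ := by
    rw [LinearMap.ker_eq_bot']
    intro g hg
    refine LinearMap.ext fun v => (Module.forall_dual_apply_eq_zero_iff ℚ_[ℓ] (g v)).mp fun φ => ?_
    have := LinearMap.congr_fun hg φ
    rw [LinearMap.zero_apply] at this
    exact LinearMap.congr_fun this v
  have h2 : LinearIndependent ℚ_[ℓ] fun i => (rationalTateModuleMap ℓ (f i)).dualMap := h1.map' _ hker
  -- base change to `ℚ_ℓ^{ac}`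
  have h3 : LinearIndependent (AlgebraicClosure ℚ_[ℓ]) fun i =>
      ((1 : AlgebraicClosure ℚ_[ℓ]) ⊗ₜ[ℚ_[ℓ]] (rationalTateModuleMap ℓ (f i)).dualMap :
        AlgebraicClosure ℚ_[ℓ] ⊗[ℚ_[ℓ]] (Module.Dual ℚ_[ℓ] (B.rationalTateModule ℓ) →ₗ[ℚ_[ℓ]] Module.Dual ℚ_[ℓ] (X.rationalTateModule ℓ))) :=
    Module.Flat.linearIndependent_one_tmul h2
  let e := homEquiv (k := ℚ_[ℓ]) (AlgebraicClosure ℚ_[ℓ]) (V := Module.Dual ℚ_[ℓ] (B.rationalTateModule ℓ))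
    (W := Module.Dual ℚ_[ℓ] (X.rationalTateModule ℓ))
  have key : (⇑e.symm.toLinearMap ∘ fun r => h1PullBar ℓ (f r)) = fun i =>
      ((1 : AlgebraicClosure ℚ_[ℓ]) ⊗ₜ[ℚ_[ℓ]] (rationalTateModuleMap ℓ (f i)).dualMap :
        AlgebraicClosure ℚ_[ℓ] ⊗[ℚ_[ℓ]] (Module.Dual ℚ_[ℓ] (B.rationalTateModule ℓ) →ₗ[ℚ_[ℓ]] Module.Dual ℚ_[ℓ] (X.rationalTateModule ℓ))) := by
    funext r
    rw [Function.comp_apply, LinearEquiv.coe_coe, LinearEquiv.symm_apply_eq, homEquiv_tmul, one_smul, h1PullBar_def]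
  refine LinearIndependent.of_comp e.symm.toLinearMap ?_
  rw [key]
  exact h3

/-- **`c ⊗ t ↦ c · t^*` is INJECTIVE on `ℚ_ℓ^{ac} ⊗_ℚ (ℚ ⊗_ℤ Hom_E(X, B))`** (`ℓ` invertible in `E`): Mumford §19 Thm 3 with
coefficients `ℚ_ℓ^{ac}`, read on `H¹` — `Hom_E(X, B)` is free of finite rank (tree `module_free_hom_holds`, `module_finite_hom_holds`)
and a `ℤ`-basis has independent pull-backs (`linearIndependent_h1PullBar`).  The injectivity half of «`Ω(μ) ⊗ ℚ_ℓ^{ac} ≃ Hom_{Gal}(…)`»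
([Liu2021] l. 2258) before cutting by the line. [cite: MumfordAV1970, §19 Thm. 3] [cite: Liu2021, Thm 4.18 proof (FJcycle.tex l. 2258–2262)] -/
theorem h1PullBarK_injective {E : Type} [Field E] (X B : AbelianVariety E) (hℓ : (ℓ : E) ≠ 0) :
    Function.Injective (h1PullBarK ℓ X B) := by
  classical
  haveI : Module.Free ℤ (X ⟶ B) := AbelianVariety.module_free_hom_holds X B
  haveI : Module.Finite ℤ (X ⟶ B) := AbelianVariety.module_finite_hom_holds X B
  let bH := Module.Free.chooseBasis ℤ (X ⟶ B)
  let bK : Module.Basis _ (AlgebraicClosure ℚ_[ℓ]) (AlgebraicClosure ℚ_[ℓ] ⊗[ℚ] RestOne.QHom X B) :=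
    Algebra.TensorProduct.basis (AlgebraicClosure ℚ_[ℓ]) (Algebra.TensorProduct.basis ℚ bH)
  have hind : LinearIndependent (AlgebraicClosure ℚ_[ℓ]) fun r => h1PullBarK ℓ X B (bK r) := by
    convert linearIndependent_h1PullBar ℓ hℓ bH.linearIndependent using 1
    funext r
    rw [Algebra.TensorProduct.basis_apply, Algebra.TensorProduct.basis_apply, h1PullBarK_tmul, one_smul, h1PullBarQ_tmul,
      Rat.cast_one, one_smul]
  refine (injective_iff_map_eq_zero _).mpr fun v hv => ?_
  rw [← bK.sum_repr v] at hv ⊢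
  rw [map_sum] at hv
  simp_rw [map_smul] at hv
  have h0 := Fintype.linearIndependent_iff.mp hind _ hv
  exact Finset.sum_eq_zero fun r _ => by rw [h0 r, zero_smul]

end Faltings

end Literature.NumberTheory.Automorphic.Liu2021.AppendixC

end
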